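import Mathlib
import Summits.Ventures.HodgeRepro2.Tier7.Target
import Summits.Ventures.HodgeRepro2.T6InterfaceK7
import Summits.Ventures.HodgeRepro2.T6A1EigenGen
import Summits.Ventures.HodgeRepro2.Tier7.Datum.CurveTensor

/-!
# Tier7/Datum/K7Half — the number-field half of the non-vacuity datum (t7-crit-1's datum of record, verbatim; t7-L1-p1)

`K = E′ = ℚ(ζ₇)` with its complex conjugation (`cmK7 : CMFieldOver K7 K7`), the standard anisotropic hermitian form on
`K7^3` (`hermK7`), the parity tetrahedron (`faceJ`), the embedding `s = τ 0` (`sJ`) with `s ∈ T 0 ∩ T 1`, `s̄ ∈ T 2 ∩ T 3`,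
the canonical eigenvectors `e i = eGen (σ i) i` (`eJ`, with `σ i = s` for `i < 2` and `s̄` otherwise) and the real
structure `barM` (componentwise `conj ⊗ id` on `H¹(B, ℂ) = (ℂ ⊗ K7)^4`) packaged as `realStrK7 : RealStr (H1C K7)`.
Everything except `sigma`/`eJ`'s labelling, `eJ_apply_ne` and `realStrK7` is copied VERBATIM from
HOME/review/OBJECTION-Target-t7-crit-1.JunkModel-frozen.lean (sha256 9c0b26dd…, ll. 276–347, 354–386, 476–496), the
datum of record of the frozen target — credited to t7-crit-1; the only change is the namespace. §8(d): NO.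
-/

/-! ## Part C — the datum `datumA` over `K = E′ = ℚ(ζ₇)` and the four deliverables (t7-L1-p1)

The number-field half (K7, `cmK7`, `hStd`/`hermK7`, the parity tetrahedron `faceJ`, `sJ`, the canonical eigenvectors
`eJ`, `disc := 1`) and the real structure `barM` on `H¹(B, ℂ)` are taken VERBATIM from t7-crit-1's datum of record
HOME/review/OBJECTION-Target-t7-crit-1.JunkModel-frozen.lean (sha256 9c0b26dd…, ll. 276–347, 354–386, 476–496;
credited — the only change is the namespace). -/

namespace Summit.Ventures.HodgeRepro2.Tier7.DatumA

open Summit.Ventures.HodgeRepro2 Summit.Ventures.HodgeRepro2.T6 Summit.Ventures.HodgeRepro2.Tier7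
open scoped TensorProduct

noncomputable section

/-! ### C.1 the number field `K7 = ℚ(ζ₇)` (t7-crit-1, verbatim) -/

/-- `K7 = ℚ(ζ₇)` (t7-crit-1) -/
abbrev K7 := CyclotomicSeven.K7

/-- `ℚ(ζ₇)` is a CM field (t7-crit-1) -/
instance instIsCMFieldK7 : NumberField.IsCMField K7 := CyclotomicSeven.isCMField_K7

/-- complex conjugation of `K7` as a ring hom (t7-crit-1) -/
def conjK7 : K7 →+* K7 := RingHomClass.toRingHom (NumberField.IsCMField.complexConj K7)

/-- unfolding `conjK7` -/
theorem conjK7_apply (x : K7) : conjK7 x = NumberField.IsCMField.complexConj K7 x := rfl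

/-- `conjK7` induces complex conjugation under every embedding -/
theorem conjK7_embed (σ : K7 →+* ℂ) (x : K7) : σ (conjK7 x) = (starRingEnd ℂ) (σ x) := by
  rw [conjK7_apply]
  exact NumberField.IsCMField.complexEmbedding_complexConj K7 σ x

/-- `conjK7` is an involution -/
theorem conjK7_conjK7 (x : K7) : conjK7 (conjK7 x) = x := by
  rw [conjK7_apply, conjK7_apply]
  exact NumberField.IsCMField.complexConj_apply_apply K7 x

/-- `K7` has a complex embedding -/
theorem nonempty_emb : Nonempty (K7 →+* ℂ) := by
  have h := NumberField.Embeddings.card K7 ℂ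
  rw [CyclotomicSeven.finrank_K7] at h
  exact Fintype.card_pos_iff.1 (by omega)

/-- `conjK7 ≠ id` -/
theorem conjK7_ne : ∃ x : K7, conjK7 x ≠ x := by
  by_contra h
  push Not at h
  obtain ⟨φ⟩ := nonempty_emb
  have hreal : NumberField.ComplexEmbedding.IsReal φ := by
    rw [NumberField.ComplexEmbedding.isReal_iff]
    ext x
    rw [NumberField.ComplexEmbedding.conjugate_coe_eq, ← conjK7_embed, h x]
  have hc : (NumberField.InfinitePlace.mk φ).IsComplex :=
    NumberField.IsTotallyComplex.isComplex (NumberField.InfinitePlace.mk φ)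
  exact (NumberField.InfinitePlace.isComplex_mk_iff.1 hc) hreal

/-- `E′ = F = ℚ(ζ₇)` (t7-crit-1) -/
def cmK7 : CMFieldOver K7 K7 where
  galK := CyclotomicSeven.isGalois_K7
  conjK := conjK7
  conjK_embed := conjK7_embed
  incl := RingHom.id K7
  galois := CyclotomicSeven.isGalois_K7
  conj := conjK7
  conj_conj := conjK7_conjK7
  conj_embed := conjK7_embed
  conj_ne := conjK7_ne
  conj_incl := fun _ => rfl
  plus_deg := by rw [CyclotomicSeven.finrank_K7]; norm_num

/-- the standard hermitian form on `K7^3` (t7-crit-1) -/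
def hStd (v w : Fin 3 → K7) : K7 := ∑ i, v i * conjK7 (w i)

/-- the standard hermitian form is anisotropic -/
theorem hStd_aniso (v : Fin 3 → K7) (hv : hStd v v = 0) : v = 0 := by
  obtain ⟨φ⟩ := nonempty_emb
  have h1 : φ (hStd v v) = 0 := by rw [hv, map_zero]
  have h2 : φ (hStd v v) = ((∑ i, Complex.normSq (φ (v i)) : ℝ) : ℂ) := by
    simp only [hStd, map_sum, map_mul, conjK7_embed, Complex.mul_conj, Complex.ofReal_sum]
  rw [h2] at h1
  have h3 : (∑ i, Complex.normSq (φ (v i)) : ℝ) = 0 := by exact_mod_cast h1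
  rw [Finset.sum_eq_zero_iff_of_nonneg (fun i _ => Complex.normSq_nonneg _)] at h3
  funext i
  have := Complex.normSq_eq_zero.1 (h3 i (Finset.mem_univ i))
  exact φ.injective (by rw [this, Pi.zero_apply, map_zero])

/-- the anisotropic hermitian 3-space `(K7^3, hStd)` (t7-crit-1) -/
def hermK7 : HermitianSpace3 cmK7 (Fin 3 → K7) where
  dim3 := Module.finrank_fin_fun K7
  h := hStd
  h_add := by intro u v w; simp [hStd, add_mul, Finset.sum_add_distrib]
  h_smul := by intro a v w; simp [hStd, Finset.mul_sum, mul_assoc]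
  h_herm := by
    intro v w
    simp only [hStd, cmK7, map_sum, map_mul, conjK7_conjK7]
    refine Finset.sum_congr rfl fun i _ => mul_comm _ _
  h_aniso := hStd_aniso

/-! ### C.2 the real structure on `H¹(B, ℂ)` (t7-crit-1's `barK` / `barM`, verbatim) -/

/-- conjugation on `ℂ ⊗ K7` (conj ⊗ id) -/
def barK : KC K7 →ₐ[ℚ] KC K7 :=
  Algebra.TensorProduct.map (starRingEnd ℂ).toRatAlgHom (AlgHom.id ℚ K7)

/-- `barK` on pure tensors -/
theorem barK_tmul (c : ℂ) (k : K7) : barK (c ⊗ₜ[ℚ] k) = (starRingEnd ℂ c) ⊗ₜ[ℚ] k := by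
  simp [barK, Algebra.TensorProduct.map_tmul]

/-- `barK` is antilinear -/
theorem barK_smul (z : ℂ) (w : KC K7) : barK (z • w) = (starRingEnd ℂ z) • barK w := by
  induction w using TensorProduct.induction_on with
  | zero => simp
  | tmul c k => rw [TensorProduct.smul_tmul', barK_tmul, barK_tmul, TensorProduct.smul_tmul', smul_eq_mul, smul_eq_mul, map_mul]
  | add u v hu hv => rw [smul_add, map_add, hu, hv, map_add, smul_add]

/-- `barK` is an involution -/
theorem barK_barK (w : KC K7) : barK (barK w) = w := by
  induction w using TensorProduct.induction_on with
  | zero => simp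
  | tmul c k => rw [barK_tmul, barK_tmul, Complex.conj_conj]
  | add u v hu hv => rw [map_add, map_add, hu, hv]

/-- conjugation on `H¹(B, ℂ)` componentwise -/
def barM (v : H1C K7) : H1C K7 := fun i => barK (v i)

/-- `barM` is additive -/
theorem barM_add (v w : H1C K7) : barM (v + w) = barM v + barM w := by
  funext i; simp [barM, map_add]

/-- `barM` is antilinear -/
theorem barM_smul (z : ℂ) (v : H1C K7) : barM (z • v) = (starRingEnd ℂ z) • barM v := by
  funext i; simp [barM, barK_smul]

/-- `barM` is an involution -/
theorem barM_barM (v : H1C K7) : barM (barM v) = v := by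
  funext i; simp [barM, barK_barK]

/-- `barM 0 = 0` -/
theorem barM_zero : barM 0 = 0 := by
  funext i; simp [barM]

/-- the real structure `barM` on `H¹(B, ℂ)` -/
def realStrK7 : RealStr (H1C K7) where
  bar := { toFun := barM, map_zero' := barM_zero, map_add' := barM_add }
  bar_smul := barM_smul
  bar_bar := barM_barM

/-! ### C.3 the face, the embedding `s`, the canonical eigenvectors (t7-crit-1, verbatim) -/

/-- the parity tetrahedron of `ℚ(ζ₇)` -/
def tau : Fin 3 → K7 →+* ℂ := Classical.choose CyclotomicSeven.exists_isWeilFace_K7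

/-- the face of the datum of record (t7-crit-1) -/
def faceJ : Face K7 where
  T := parityTetrahedron K7 tau
  face := Classical.choose_spec CyclotomicSeven.exists_isWeilFace_K7

/-- the embedding `s = τ 0` (t7-crit-1) -/
def sJ : K7 →+* ℂ := tau 0

/-- `s̄` as the conjugate embedding -/
theorem sbar_eq : (starRingEnd ℂ).comp sJ = NumberField.ComplexEmbedding.conjugate sJ := by
  ext x
  simp [NumberField.ComplexEmbedding.conjugate_coe_eq]

/-- `s ∈ T 0` -/
theorem sJ_mem0 : sJ ∈ faceJ.T 0 := ⟨0, by simp [sJ]⟩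
/-- `s ∈ T 1` -/
theorem sJ_mem1 : sJ ∈ faceJ.T 1 := ⟨0, by simp [sJ]⟩
/-- `s̄ ∈ T 2` -/
theorem sbar_mem2 : (starRingEnd ℂ).comp sJ ∈ faceJ.T 2 := ⟨0, by rw [sbar_eq]; simp [sJ]⟩
/-- `s̄ ∈ T 3` -/
theorem sbar_mem3 : (starRingEnd ℂ).comp sJ ∈ faceJ.T 3 := ⟨0, by rw [sbar_eq]; simp [sJ]⟩

/-- the embedding labelling the corners of `e i` -/
def sigma (i : Fin 4) : K7 →+* ℂ := if (i : ℕ) < 2 then sJ else (starRingEnd ℂ).comp sJ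

/-- the canonical eigenvectors `e i = eGen (σ i) i` -/
def eJ (i : Fin 4) : H1C K7 := A1EigenGen.eGen K7 (sigma i) i

/-- the `i`-th component of `e i` is the generator `v (σ i)` -/
theorem eJ_apply_self (i : Fin 4) : eJ i i = A1EigenGen.vGen K7 (sigma i) :=
  A1EigenGen.eGen_apply_self K7 (sigma i) i

/-- the other components of `e i` vanish -/
theorem eJ_apply_ne (i j : Fin 4) (h : j ≠ i) : eJ i j = 0 := by
  simp only [eJ, A1EigenGen.eGen, LinearMap.single_apply]
  exact Pi.single_eq_of_ne h _

/-- `e i ≠ 0` -/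
theorem eJ_ne_zero (i : Fin 4) : eJ i ≠ 0 := A1EigenGen.eGen_ne_zero K7 (sigma i) i

end

end Summit.Ventures.HodgeRepro2.Tier7.DatumA
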